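import Literature.NumberTheory.NumberFields.CyclicPrimePowerUniquePrimeOver
import Literature.NumberTheory.IwasawaTheory.ClassicalMuVanishesImaginaryQuadraticTwoProofs
import Literature.NumberTheory.EllipticCurves.CyclotomicZpExtensionLayerOneSqrtTwoProofs
import Literature.NumberTheory.EllipticCurves.ZpExtensionLayerCharacter
import Literature.NumberTheory.GaloisRepresentations.BrauerCyclicLayer
import Literature.NumberTheory.QuadraticFields.KroneckerSplitting
import Literature.NumberTheory.QuadraticFields.ImaginaryQuadraticPrescribedSplittingInert
import Literature.NumberTheory.QuadraticFields.DiscriminantOfSqrt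
import Mathlib.NumberTheory.LegendreSymbol.QuadraticReciprocity
import HarnessLib

/-!
# Decomposition of an odd prime in the layers `ℚ_n` of the cyclotomic `ℤ₂`-extension of `ℚ`:
# for `n ≥ 1`, `ℓ` has exactly ONE prime above it in `ℚ_n` iff `ℓ ≡ ±3 (mod 8)`; its number of primes is otherwise even;
# `ℚ_n` is unramified at every odd prime (proved; no definition, no named fact)

Topic `NumberTheory/IwasawaTheory` (namespace = path).  THEOREM-ONLY file, written by the prover seat `bsd-line-att-p3` g30
(cell `bsd-f1-sign2`; `--supports` stmt-BirchSwinnertonDyer-22298; closes nothing).  `κ` is a CYCLOTOMIC `ℤ₂`-extension of `ℚ`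
(`κ.IsCyclotomic`), `ℚ_n = κ.layer n ⊆ ℚ̄` its `n`-th layer (`[ℚ_n : ℚ] = 2ⁿ`, `ℚ_1 = ℚ(√2)`, `ℚ_n ⊆ ℚ(ζ_{2^{n+2}})`), and for a
rational prime `ℓ`, `g_n(ℓ) = #{primes of 𝓞 ℚ_n above ℓ}`.

* §1 `discr_layer_one` — `d(ℚ_1) = 8` (`ℚ_1 ∋ √2`, tree `IsCyclotomic.exists_sq_eq_two_layer_one`; `d(ℚ(√m)) = 4m` for
  `m ≡ 2 (mod 4)` squarefree); **`ncard_primesOver_layer_one_eq_one_iff`** — for an odd prime `ℓ`: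
  `g_1(ℓ) = 1 ⟺ ℓ ≡ 3, 5 (mod 8)` (decomposition law in `ℚ(√2)`: `(8/ℓ) = (2/ℓ) = χ₈(ℓ)`).
* §2 `isCyclic_aut_layer` (`Gal(ℚ_n/ℚ)` is cyclic), **`ncard_primesOver_layer_eq_one_iff`** — for `n ≥ 1` and `ℓ` odd:
  **`g_n(ℓ) = 1 ⟺ ℓ ≡ 3, 5 (mod 8)`** («inert in `ℚ_1` ⟺ inert in every `ℚ_n`», the cyclic `2`-group lemma
  `ncard_primesOver_eq_one_iff_of_isCyclic` of `NumberFields/CyclicPrimePowerUniquePrimeOver`); **`odd_ncard_primesOver_layer_iff`**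
  — `g_n(ℓ)` is ODD iff `ℓ ≡ 3, 5 (mod 8)` (`g_n(ℓ) ∣ 2ⁿ`); `ncard_primesOver_layer_zero` — `g_0(ℓ) = 1`.
* §3 `ramificationIdx_eq_one_of_liesOver_layer` — every prime of `ℚ_n` above an ODD `ℓ` has `e = 1` over `ℤ`
  (`ℚ_n ⊆ ℚ(ζ_{2^{n+2}})`, unramified outside `2`, and `e` is multiplicative in towers); `isUnramifiedIn_layer_span`,
  **`not_dvd_discr_layer`** — `ℓ ∤ d(ℚ_n)` for odd `ℓ`.

These feed the exact genus count `rank₂ Cl((K·ℚ_∞)_n) = t_n − 1` of `ImaginaryQuadraticTwoTowerGenusRank.lean` (the tree's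
`ClassicalMuVanishesImaginaryQuadraticTwoProofs` bounds `t_n`; here its parity becomes computable: `t_n ≡ #{ℓ ∣ d_K : ℓ ≡ ±3 (8)}`).

HONEST SCOPE: textbook (Washington §13.1: a prime is finitely decomposed in `ℚ_∞` and then inert; the exact number
`2^{min(n, ord₂(ℓ²−1)−3)}` of primes is NOT proved here — only the criterion for `1` and the parity).  Nothing here is specific to
any summit; BSD is not proved by any of this.

## References
* L. C. Washington, *Introduction to Cyclotomic Fields*, 2nd ed. (1997), Thm. 2.13, Prop. 2.3, §13.1. [Washington1997]
* D. A. Marcus, *Number Fields*, 2nd ed. (2018), Ch. 2 Thm. 1 (`d(ℚ(√m))`), Ch. 3 Thm. 25 (decomposition in quadratic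
  fields), Ch. 4 Thm. 28. [Marcus2018]
-/

set_option autoImplicit false

noncomputable section

open scoped NumberField
open NumberField IsDedekindDomain Field IntermediateField Module Ideal

namespace Literature.NumberTheory.IwasawaTheory

open Literature.NumberTheory.EllipticCurves Literature.NumberTheory.EllipticCurves.ZpExtension
  Literature.NumberTheory.GaloisRepresentations Literature.NumberTheory.NumberFields
  Literature.NumberTheory.QuadraticFields.Quadratic

variable {κ : ZpExtension ℚ 2} (hκ : κ.IsCyclotomic)

/-! ## §1 The first layer `ℚ_1 = ℚ(√2)`: discriminant `8`, and the decomposition law `(2/ℓ) = χ₈(ℓ)` -/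

section LayerOne

include hκ in
/-- **`d(ℚ_1) = 8`**: the first layer of a cyclotomic `ℤ₂`-extension of `ℚ` is the quadratic field `ℚ(√2)` (`θ² = 2` with
`θ ∈ ℚ_1`, `[ℚ_1 : ℚ] = 2`), and `d(ℚ(√2)) = 4·2`. [cite: Marcus2018, Ch. 2 Thm. 1] [cite: Washington1997, §13.1] -/
theorem discr_layer_one :
    (haveI : FiniteDimensional ℚ ↥(κ.layer 1) := κ.finiteDimensional_layer_holds 1
     haveI : NumberField ↥(κ.layer 1) := NumberField.of_module_finite ℚ _
     NumberField.discr ↥(κ.layer 1)) = 8 := by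
  haveI : FiniteDimensional ℚ ↥(κ.layer 1) := κ.finiteDimensional_layer_holds 1
  haveI : NumberField ↥(κ.layer 1) := NumberField.of_module_finite ℚ _
  obtain ⟨θ, hθ⟩ := IsCyclotomic.exists_sq_eq_two_layer_one hκ
  have h2 : Module.finrank ℚ ↥(κ.layer 1) = 2 := by rw [κ.finrank_layer_holds 1, pow_one]
  have hθ' : θ ^ 2 = ((2 : ℤ) : ↥(κ.layer 1)) := by rw [hθ]; norm_num
  rw [discr_eq_four_mul_of_sq_eq_intCast h2 hθ' (Or.inl (by decide)) (Int.squarefree_natCast.mpr Nat.squarefree_two)]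
  norm_num

/-- `(8/ℓ) = χ₈(ℓ)` for an odd prime `ℓ`: `8 = 2² · 2`. [cite: Washington1997, Prop. 2.3 (quadratic characters)] -/
theorem legendreSym_eight_eq_χ₈ {ℓ : ℕ} [Fact ℓ.Prime] (hℓ2 : ℓ ≠ 2) : legendreSym ℓ 8 = ZMod.χ₈ ℓ := by
  have h2 : ((2 : ℤ) : ZMod ℓ) ≠ 0 := by
    intro h
    have h' : ((2 : ℕ) : ZMod ℓ) = 0 := by exact_mod_cast h
    rw [ZMod.natCast_eq_zero_iff] at h'
    exact hℓ2 ((Nat.prime_dvd_prime_iff_eq (Fact.out) Nat.prime_two).mp h')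
  rw [show (8 : ℤ) = 2 ^ 2 * 2 by norm_num, legendreSym.mul, legendreSym.sq_one' ℓ h2, one_mul, legendreSym.at_two hℓ2]

/-- `χ₈(ℓ) = −1 ⟺ ℓ ≡ 3, 5 (mod 8)` and `χ₈(ℓ) = 1 ⟺ ℓ ≡ 1, 7 (mod 8)`, for odd `ℓ`. [cite: Washington1997, Prop. 2.3] -/
theorem χ₈_natCast_eq_neg_one_iff {ℓ : ℕ} (hodd : Odd ℓ) : ZMod.χ₈ ℓ = -1 ↔ ℓ % 8 = 3 ∨ ℓ % 8 = 5 := by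
  rw [ZMod.χ₈_nat_eq_if_mod_eight]
  have h := Nat.odd_iff.mp hodd
  have h8 : ℓ % 8 = 1 ∨ ℓ % 8 = 3 ∨ ℓ % 8 = 5 ∨ ℓ % 8 = 7 := by omega
  rcases h8 with h8 | h8 | h8 | h8 <;> simp [h8] <;> omega

include hκ in
/-- **Decomposition of an odd prime in `ℚ_1 = ℚ(√2)`: exactly one prime above `ℓ` iff `ℓ ≡ 3, 5 (mod 8)`** (`ℓ` is inert iff
`(2/ℓ) = −1`, and splits into two primes iff `(2/ℓ) = 1`). [cite: Marcus2018, Ch. 3 Thm. 25] [cite: Washington1997, §13.1] -/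
theorem ncard_primesOver_layer_one_eq_one_iff {ℓ : ℕ} (hℓ : ℓ.Prime) (hℓ2 : ℓ ≠ 2) :
    (haveI : FiniteDimensional ℚ ↥(κ.layer 1) := κ.finiteDimensional_layer_holds 1
     haveI : NumberField ↥(κ.layer 1) := NumberField.of_module_finite ℚ _
     ((Ideal.span {(ℓ : ℤ)}).primesOver (𝓞 ↥(κ.layer 1))).ncard = 1) ↔ ℓ % 8 = 3 ∨ ℓ % 8 = 5 := by
  haveI : FiniteDimensional ℚ ↥(κ.layer 1) := κ.finiteDimensional_layer_holds 1
  haveI : NumberField ↥(κ.layer 1) := NumberField.of_module_finite ℚ _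
  haveI : Fact ℓ.Prime := ⟨hℓ⟩
  have h2 : Module.finrank ℚ ↥(κ.layer 1) = 2 := by rw [κ.finrank_layer_holds 1, pow_one]
  have hd := discr_layer_one hκ
  have hodd : Odd ℓ := hℓ.odd_of_ne_two hℓ2
  rw [← χ₈_natCast_eq_neg_one_iff hodd, ← legendreSym_eight_eq_χ₈ hℓ2, ← hd]
  constructor
  · intro h1
    -- if `(d/ℓ) ≠ -1` then (as `ℓ ∤ d = 8`) `(d/ℓ) = 1` and `ℓ` splits into two primes
    by_contra hne
    have h0 : ((NumberField.discr ↥(κ.layer 1) : ℤ) : ZMod ℓ) ≠ 0 := by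
      rw [hd]
      intro h
      have h' : ((8 : ℕ) : ZMod ℓ) = 0 := by exact_mod_cast h
      rw [ZMod.natCast_eq_zero_iff] at h'
      have := hℓ.dvd_of_dvd_pow (show ℓ ∣ 2 ^ 3 by simpa using h')
      exact hℓ2 ((Nat.prime_dvd_prime_iff_eq hℓ Nat.prime_two).mp this)
    have hone : legendreSym ℓ (NumberField.discr ↥(κ.layer 1)) = 1 :=
      (legendreSym.eq_one_or_neg_one ℓ h0).resolve_right hne
    have htwo := (ncard_primesOver_eq_two_iff_legendreSym h2 hℓ2).mpr hone
    omega
  · intro h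
    exact ncard_primesOver_eq_one_of_legendreSym_eq_neg_one h2 h

end LayerOne

/-! ## §2 The layers `ℚ_n`, `n ≥ 1`: one prime above `ℓ` iff `ℓ ≡ ±3 (mod 8)`; parity of the number of primes -/

section Layer

/-- **`Gal(ℚ_n/ℚ)` (indeed `Gal(K_n/K)` for any `ℤ_p`-extension) is cyclic** (`≅ ℤ/pⁿ` through the layer character
`κ mod pⁿ`). [cite: Washington1997, §13.1] -/
theorem isCyclic_aut_layer {K : Type} [Field K] [NumberField K] {p : ℕ} [Fact p.Prime] (κ : ZpExtension K p) (n : ℕ) :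
    IsCyclic (↥(κ.layer n) ≃ₐ[K] ↥(κ.layer n)) := by
  haveI : IsGalois K ↥(κ.layer n) := κ.isGalois_layer_holds n
  haveI : NeZero (p ^ n) := ⟨pow_ne_zero n (Fact.out : p.Prime).ne_zero⟩
  obtain ⟨ψ, -, hker, -⟩ := κ.exists_cyclicCharacter_layer n
  exact isCyclic_of_cyclicLayer ψ (κ.layer n) hker

include hκ in
/-- **An odd prime `ℓ` has exactly ONE prime above it in `ℚ_n` (`n ≥ 1`) iff `ℓ ≡ 3, 5 (mod 8)`** — «a prime inert in
`ℚ_1 = ℚ(√2)` stays inert in every layer of the `ℤ₂`-tower, a prime split in `ℚ_1` has at least two primes in every higher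
layer»: `Gal(ℚ_n/ℚ)` is cyclic of order `2ⁿ` and `ℚ_1 ⊆ ℚ_n` is a subfield `≠ ℚ` (`NumberFields.ncard_primesOver_eq_one_iff_of_isCyclic`).
[cite: Washington1997, §13.1] [cite: Marcus2018, Ch. 4 Thm. 28] -/
theorem ncard_primesOver_layer_eq_one_iff {n : ℕ} (hn : 1 ≤ n) {ℓ : ℕ} (hℓ : ℓ.Prime) (hℓ2 : ℓ ≠ 2) :
    (haveI : FiniteDimensional ℚ ↥(κ.layer n) := κ.finiteDimensional_layer_holds n
     haveI : NumberField ↥(κ.layer n) := NumberField.of_module_finite ℚ _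
     ((Ideal.span {(ℓ : ℤ)}).primesOver (𝓞 ↥(κ.layer n))).ncard = 1) ↔ ℓ % 8 = 3 ∨ ℓ % 8 = 5 := by
  haveI : FiniteDimensional ℚ ↥(κ.layer n) := κ.finiteDimensional_layer_holds n
  haveI : NumberField ↥(κ.layer n) := NumberField.of_module_finite ℚ _
  haveI : FiniteDimensional ℚ ↥(κ.layer 1) := κ.finiteDimensional_layer_holds 1
  haveI : NumberField ↥(κ.layer 1) := NumberField.of_module_finite ℚ _
  haveI : IsGalois ℚ ↥(κ.layer n) := κ.isGalois_layer_holds n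
  haveI : IsCyclic (↥(κ.layer n) ≃ₐ[ℚ] ↥(κ.layer n)) := isCyclic_aut_layer κ n
  letI : Algebra ↥(κ.layer 1) ↥(κ.layer n) := (IntermediateField.inclusion (κ.layer_mono hn)).toRingHom.toAlgebra
  haveI : IsScalarTower ℚ ↥(κ.layer 1) ↥(κ.layer n) := IsScalarTower.of_algebraMap_eq fun _ => rfl
  have h1 : 1 < Module.finrank ℚ ↥(κ.layer 1) := by rw [κ.finrank_layer_holds 1]; norm_num
  rw [ncard_primesOver_eq_one_iff_of_isCyclic ↥(κ.layer n) ↥(κ.layer 1) Nat.prime_two (κ.finrank_layer_holds n) h1 hℓ]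
  exact ncard_primesOver_layer_one_eq_one_iff hκ hℓ hℓ2

include hκ in
/-- **Parity of the number of primes of `ℚ_n` above an odd prime `ℓ`** (`n ≥ 1`): `g_n(ℓ) ∣ 2ⁿ` is odd iff it is `1`, iff
`ℓ ≡ 3, 5 (mod 8)`. [cite: Washington1997, §13.1] -/
theorem odd_ncard_primesOver_layer_iff {n : ℕ} (hn : 1 ≤ n) {ℓ : ℕ} (hℓ : ℓ.Prime) (hℓ2 : ℓ ≠ 2) :
    (haveI : FiniteDimensional ℚ ↥(κ.layer n) := κ.finiteDimensional_layer_holds n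
     haveI : NumberField ↥(κ.layer n) := NumberField.of_module_finite ℚ _
     Odd ((Ideal.span {(ℓ : ℤ)}).primesOver (𝓞 ↥(κ.layer n))).ncard) ↔ ℓ % 8 = 3 ∨ ℓ % 8 = 5 := by
  haveI : FiniteDimensional ℚ ↥(κ.layer n) := κ.finiteDimensional_layer_holds n
  haveI : NumberField ↥(κ.layer n) := NumberField.of_module_finite ℚ _
  haveI : IsGalois ℚ ↥(κ.layer n) := κ.isGalois_layer_holds n
  rw [odd_ncard_primesOver_iff_eq_one ↥(κ.layer n) (κ.finrank_layer_holds n) hℓ]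
  exact ncard_primesOver_layer_eq_one_iff hκ hn hℓ hℓ2

/-- **`g_0(ℓ) = 1`**: the layer `ℚ_0` has degree `1`, and `g ∣ [ℚ_0 : ℚ]`. [cite: Washington1997, §13.1] -/
theorem ncard_primesOver_layer_zero {p : ℕ} [Fact p.Prime]
    (κ' : ZpExtension ℚ p) {ℓ : ℕ} (hℓ : ℓ.Prime) :
    (haveI : FiniteDimensional ℚ ↥(κ'.layer 0) := κ'.finiteDimensional_layer_holds 0
     haveI : NumberField ↥(κ'.layer 0) := NumberField.of_module_finite ℚ _
     ((Ideal.span {(ℓ : ℤ)}).primesOver (𝓞 ↥(κ'.layer 0))).ncard) = 1 := by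
  haveI : FiniteDimensional ℚ ↥(κ'.layer 0) := κ'.finiteDimensional_layer_holds 0
  haveI : NumberField ↥(κ'.layer 0) := NumberField.of_module_finite ℚ _
  haveI : IsGalois ℚ ↥(κ'.layer 0) := κ'.isGalois_layer_holds 0
  have h := ncard_primesOver_dvd_finrank ↥(κ'.layer 0) hℓ
  rw [κ'.finrank_layer_holds 0, pow_zero] at h
  exact Nat.eq_one_of_dvd_one h

end Layer

/-! ## §3 `ℚ_n` is unramified at every odd prime -/

section Unramified

variable (n : ℕ)

include hκ in
/-- **Every prime of `ℚ_n` above an odd prime `ℓ` is unramified over `ℚ`: `e(w ∣ ℓ) = 1`.**  `ℚ_n ⊆ C = ℚ(ζ_{2^{n+2}})` and for a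
prime `𝔔 ∣ w` of `C`: `e(𝔔 ∣ ℓ) = e(w ∣ ℓ) · e(𝔔 ∣ w)` with `e(𝔔 ∣ ℓ) = 1` (`ℓ ∤ 2^{n+2}` is unramified in `C`, Mathlib).
[cite: Washington1997, Prop. 2.3 and §13.1] -/
theorem ramificationIdx_eq_one_of_liesOver_layer {ℓ : ℕ} (hℓ : ℓ.Prime) (hℓ2 : ℓ ≠ 2)
    [NumberField ↥(κ.layer n)] (w : Ideal (𝓞 ↥(κ.layer n))) [w.IsPrime] [w.LiesOver (Ideal.span {(ℓ : ℤ)})] :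
    w.ramificationIdx ℤ = 1 := by
  haveI : Fact ℓ.Prime := ⟨hℓ⟩
  haveI : (Ideal.span {(ℓ : ℤ)}).IsMaximal := Int.ideal_span_isMaximal_of_prime ℓ
  haveI : NeZero (((2 ^ (n + 2) : ℕ) : ℚ)) := ⟨by positivity⟩
  obtain ⟨ζ, hζ⟩ := HasEnoughRootsOfUnity.exists_primitiveRoot (AlgebraicClosure ℚ) (2 ^ (n + 2))
  haveI : Algebra.IsAlgebraic ℚ (AlgebraicClosure ℚ) := AlgebraicClosure.isAlgebraic ℚ
  haveI hC : IsCyclotomicExtension {2 ^ (n + 2)} ℚ ↥ℚ⟮ζ⟯ := hζ.intermediateField_adjoin_isCyclotomicExtension ℚ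
  haveI : FiniteDimensional ℚ ↥ℚ⟮ζ⟯ := IsCyclotomicExtension.finite {2 ^ (n + 2)} ℚ ↥ℚ⟮ζ⟯
  haveI : NumberField ↥ℚ⟮ζ⟯ := NumberField.of_module_finite ℚ _
  have hle : κ.layer n ≤ ℚ⟮ζ⟯ := layer_le_adjoin_of_isPrimitiveRoot hκ n hζ
  letI : Algebra ↥(κ.layer n) ↥ℚ⟮ζ⟯ := (IntermediateField.inclusion hle).toRingHom.toAlgebra
  haveI : IsScalarTower ℚ ↥(κ.layer n) ↥ℚ⟮ζ⟯ := IsScalarTower.of_algebraMap_eq fun _ => rfl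
  -- a prime `𝔔` of `C` above `w`
  have hℓ0 : (Ideal.span {(ℓ : ℤ)}) ≠ ⊥ := by
    rw [Ne, Ideal.span_singleton_eq_bot]; exact_mod_cast hℓ.ne_zero
  haveI : w.IsMaximal := Ideal.IsPrime.isMaximal inferInstance (Ideal.ne_bot_of_liesOver_of_ne_bot hℓ0 w)
  obtain ⟨⟨𝔔, h𝔔, h𝔔w⟩⟩ := w.nonempty_primesOver (S := 𝓞 ↥ℚ⟮ζ⟯)
  haveI := h𝔔
  haveI := h𝔔w
  haveI : 𝔔.LiesOver (Ideal.span {(ℓ : ℤ)}) := Ideal.LiesOver.trans 𝔔 w (Ideal.span {(ℓ : ℤ)})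
  have hndvd : ¬ ℓ ∣ 2 ^ (n + 2) := fun h =>
    hℓ2 ((Nat.prime_dvd_prime_iff_eq hℓ Nat.prime_two).mp (hℓ.dvd_of_dvd_pow h))
  haveI : NeZero (2 ^ (n + 2)) := ⟨pow_ne_zero _ two_ne_zero⟩
  have h1 : 𝔔.ramificationIdx ℤ = 1 := IsCyclotomicExtension.Rat.ramificationIdx_eq_of_not_dvd ℓ ↥ℚ⟮ζ⟯ 𝔔 hndvd
  have htower := Ideal.ramificationIdx_tower (R := ℤ) (q := w) (r := 𝔔)
  rw [h1] at htower
  exact (Nat.eq_one_of_mul_eq_one_right htower.symm)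

include hκ in
/-- **`ℚ_n` is unramified at every odd prime `ℓ`** (`Algebra.IsUnramifiedIn (𝓞 ℚ_n) (ℓ)`). [cite: Washington1997, §13.1 Prop. 13.2] -/
theorem isUnramifiedIn_layer_span {ℓ : ℕ} (hℓ : ℓ.Prime) (hℓ2 : ℓ ≠ 2) [NumberField ↥(κ.layer n)] :
    Algebra.IsUnramifiedIn (𝓞 ↥(κ.layer n)) (Ideal.span {(ℓ : ℤ)}) := by
  rw [Algebra.isUnramifiedIn_iff_forall_ramificationIdx_eq_one]
  intro w _ hw
  exact ramificationIdx_eq_one_of_liesOver_layer hκ n hℓ hℓ2 w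

include hκ in
/-- **`ℓ ∤ d(ℚ_n)` for every odd prime `ℓ`** (Dedekind's discriminant theorem, Mathlib `not_dvd_discr_iff_isUnramifiedIn`).
[cite: Washington1997, §13.1 Prop. 13.2] -/
theorem not_dvd_discr_layer {ℓ : ℕ} (hℓ : ℓ.Prime) (hℓ2 : ℓ ≠ 2) [NumberField ↥(κ.layer n)] :
    ¬ (ℓ : ℤ) ∣ NumberField.discr ↥(κ.layer n) :=
  (NumberField.not_dvd_discr_iff_isUnramifiedIn ↥(κ.layer n) (𝓞 ↥(κ.layer n)) (Nat.prime_iff_prime_int.mp hℓ)).mpr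
    (isUnramifiedIn_layer_span hκ n hℓ hℓ2)

end Unramified

end Literature.NumberTheory.IwasawaTheory

end
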